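import Mathlib
import HarnessLib
import HarnessLib.Audit
import Summits.HodgeConjecture.HodgeConjecture.Theses.TropicalKugaSatakeCayley

/-!
# Birth skeleton (BC3) — crux `EffectiveCayleyNonRealizability` (K1) of route `TropicalKugaSatakeCayley`

Crux item `stmt-HodgeConjecture-18569`; crux decl
`Summit.HodgeConjecture.HodgeConjecture.Theses.TropicalKugaSatakeCayley.EffectiveCayleyNonRealizability`.

K1 says: a period class `M ∈ Matrix (Sub 8 2) (Sub 8 2) ℝ` that is realised by EFFECTIVE framed simplicial
tropical 2-cycles of `ℝ⁸ / B_t ℤ⁸` at every parameter `t` of a non-empty open subset of the Kuga–Satake cone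
`ksPosCone` is a real multiple of the theta class `1` (no Cayley component).

Notation used informally below (everything is INLINED in the signatures, no new definitions):
* `R` = the set of OPEN-EFFECTIVELY-REALISABLE classes
  `{M | ∃ U open, non-empty, U ⊆ ksPosCone, ∀ t ∈ U, ∃ Z, Z.IsCycle (ksMatrix t) ∧ Z.Effective ∧ compound 2 (ksMatrix t)⁻¹ * Z.classOf = M}`;
* `K` = the GENERIC tropical Hodge (2,2)-classes of the family in period coordinates
  `{M | ∀ t ∈ ksPosCone, eigenwave (compound 2 (ksMatrix t) * M) = 0}` (a real subspace; `dim K = 6 = 1 (theta) + 5 (Cayley)`,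
  van Geemen–Verra Cor. 6.5 / Lemma 6.8 on the abelian side, exact linear algebra on the tropical side).

The line (the prior programme's "Reformulation", effective + open form): K1 ⇐ ALL-OR-NOTHING ∧ NOT-ALL-REALISABLE.
* `stub_allOrNothing` (load-bearing): if ONE open-effectively-realisable class is not a theta multiple, then EVERY
  generic Hodge class lies in the real span of open-effectively-realisable classes. Mechanism: push-forwards of
  effective cycles by the isogenies `B₁ h B₁⁻¹`, `h` in the Hurwitz order `D = End` (the commutant of the Clifford
  generators `ksClifford`), act on `R` uniformly in `t` (because `h` commutes with `B_t B₁⁻¹`), so `span R` is a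
  `D^×`-submodule of `K` containing `1`; and `K = ℝ•1 ⊕ Cayley` with the 5-dimensional Cayley part absolutely
  irreducible (vGV Lemma 6.8), so a submodule with a non-theta element is everything.
* `stub_notAllRealizable` (load-bearing): SOME generic Hodge class is not in the real span of the
  open-effectively-realisable ones — the genuinely open core (Kontsevich's non-realisability for one class).
* `stub_rung_isotypicTheta` (BC5 plan-only rung, NOT consumed by the assembly): a generic Hodge class invariant
  under all the similitude push-forwards `M ↦ compound 2 h • M • (compound 2 (B₁ h B₁⁻¹))ᵀ` (`h` integral, commuting
  with the Clifford generators, `h h† = ν`) is a theta multiple — finite linear algebra (the `D^×`-invariants of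
  `K` are `ℝ•1`), the first rung of the all-or-nothing mechanism; decidable in principle by exact computation.

Assembly `EffectiveCayleyNonRealizability_of` (sorry-free logic): given `U, M` realised on `U` with `M ∉ ℝ•1`,
`M ∈ R` witnesses the hypothesis of `stub_allOrNothing`, so `K ⊆ span R`, contradicting `stub_notAllRealizable`.

Sources: MikhalkinZharkov2014Eigenwave (§5–6, Thm. 5.4), Zharkov2020TropicalWeil (pp. 2–3),
vanGeemenVerra2003QuaternionicPryms (§6: Cor. 6.5, Lemma 6.8), AminiPiquerez2020TropicalHC (Thm. 1.1).
-/

namespace Summit.HodgeConjecture.HodgeConjecture.Cruxes.EffectiveCayleyNonRealizability.Birth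

open Literature.AlgebraicGeometry.Tropical Literature.AlgebraicGeometry.Tropical.TropicalTorus
open Summit.HodgeConjecture.HodgeConjecture.Theses.TropicalKugaSatakeCayley

/-- STUB (load-bearing) ALL-OR-NOTHING: if some open-effectively-realisable period class is not a theta multiple,
then every generic tropical Hodge (2,2)-class of the Kuga–Satake family lies in the real span of the
open-effectively-realisable classes (`span R` is a `D^×`-submodule of `K = ℝ•1 ⊕ Cayley` containing `1`, and the
Cayley part is absolutely irreducible — van Geemen–Verra Lemma 6.8). -/
theorem stub_allOrNothing :
    (∃ M ∈ {M : Matrix (Sub 8 2) (Sub 8 2) ℝ | ∃ U : Set (Fin 5 → ℝ), IsOpen U ∧ U.Nonempty ∧ U ⊆ ksPosCone ∧ ∀ t ∈ U, ∃ Z : Chain ℝ 8 2, Z.IsCycle (ksMatrix t) ∧ Z.Effective ∧ compound 2 (ksMatrix t)⁻¹ * Z.classOf = M}, ∀ r : ℝ, M ≠ r • (1 : Matrix (Sub 8 2) (Sub 8 2) ℝ)) → {M : Matrix (Sub 8 2) (Sub 8 2) ℝ | ∀ t ∈ ksPosCone, eigenwave (compound 2 (ksMatrix t) * M) = 0} ⊆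 (Submodule.span ℝ {M : Matrix (Sub 8 2) (Sub 8 2) ℝ | ∃ U : Set (Fin 5 → ℝ), IsOpen U ∧ U.Nonempty ∧ U ⊆ ksPosCone ∧ ∀ t ∈ U, ∃ Z : Chain ℝ 8 2, Z.IsCycle (ksMatrix t) ∧ Z.Effective ∧ compound 2 (ksMatrix t)⁻¹ * Z.classOf = M} : Set (Matrix (Sub 8 2) (Sub 8 2) ℝ)) := by
  sorry

/-- STUB (load-bearing) NOT-ALL-REALISABLE: some generic tropical Hodge (2,2)-class of the family is not in the
real span of the open-effectively-realisable classes (Kontsevich non-realisability for at least one class; the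
open core of K1). -/
theorem stub_notAllRealizable :
    ∃ M₀ ∈ {M : Matrix (Sub 8 2) (Sub 8 2) ℝ | ∀ t ∈ ksPosCone, eigenwave (compound 2 (ksMatrix t) * M) = 0}, M₀ ∉ (Submodule.span ℝ {M : Matrix (Sub 8 2) (Sub 8 2) ℝ | ∃ U : Set (Fin 5 → ℝ), IsOpen U ∧ U.Nonempty ∧ U ⊆ ksPosCone ∧ ∀ t ∈ U, ∃ Z : Chain ℝ 8 2, Z.IsCycle (ksMatrix t) ∧ Z.Effective ∧ compound 2 (ksMatrix t)⁻¹ * Z.classOf = M} : Set (Matrix (Sub 8 2) (Sub 8 2) ℝ)) := by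
  sorry

/-- STUB (BC5 plan-only rung; not consumed by the assembly) ISOTYPIC-THETA: a generic tropical Hodge (2,2)-class
that is invariant under every similitude push-forward `M ↦ ⋀²h • M • (⋀²(B₁ h B₁⁻¹))ᵀ = ν² • M` (`h` integral,
commuting with the Clifford generators, `h • h† = ν • 1` for the adjoint `h† = B₁⁻¹ hᵀ B₁`) is a real multiple of
the theta class `1` — the `D^×`-invariants of `K` are `ℝ•1` (finite exact linear algebra; technique: compute the
invariant subspace of the explicit 6-dimensional `K`). -/
theorem stub_rung_isotypicTheta :
    ∀ M : Matrix (Sub 8 2) (Sub 8 2) ℝ, (∀ t : Fin 5 → ℝ, eigenwave (compound 2 (ksMatrix t) * M) = 0) → (∀ (h : Matrix (Fin 8) (Fin 8) ℤ) (ν : ℤ), (∀ l : Fin 4, h * ksClifford l = ksClifford l * h) → h.map (Int.cast : ℤ → ℝ) * ((ksBase.map (Int.cast : ℤ → ℝ))⁻¹ * (h.map (Int.cast : ℤ → ℝ)).transpose * ksBase.map (Int.cast : ℤ → ℝ)) = (ν : ℝ) • (1 : Matrix (Fin 8) (Fin 8) ℝ) → compound 2 (h.map (Int.cast : ℤ →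 ℝ)) * M * (compound 2 (ksBase.map (Int.cast : ℤ → ℝ) * h.map (Int.cast : ℤ → ℝ) * (ksBase.map (Int.cast : ℤ → ℝ))⁻¹)).transpose = ((ν : ℝ) ^ 2) • M) → ∃ r : ℝ, M = r • (1 : Matrix (Sub 8 2) (Sub 8 2) ℝ) := by
  sorry

/-- ASSEMBLY (sorry-free logic; the registered skeleton theorem): concludes the crux
`EffectiveCayleyNonRealizability` BY NAME from `stub_allOrNothing` and `stub_notAllRealizable`.
The `have` is the hypotheses form `⟨allOrNothing⟩ → ⟨notAllRealizable⟩ → EffectiveCayleyNonRealizability`. -/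
theorem EffectiveCayleyNonRealizability_of : EffectiveCayleyNonRealizability := by
  have key :
      ((∃ M ∈ {M : Matrix (Sub 8 2) (Sub 8 2) ℝ | ∃ U : Set (Fin 5 → ℝ), IsOpen U ∧ U.Nonempty ∧ U ⊆ ksPosCone ∧ ∀ t ∈ U, ∃ Z : Chain ℝ 8 2, Z.IsCycle (ksMatrix t) ∧ Z.Effective ∧ compound 2 (ksMatrix t)⁻¹ * Z.classOf = M}, ∀ r : ℝ, M ≠ r • (1 : Matrix (Sub 8 2) (Sub 8 2) ℝ)) → {M : Matrix (Sub 8 2) (Sub 8 2) ℝ | ∀ t ∈ ksPosCone, eigenwave (compound 2 (ksMatrix t) * M) = 0} ⊆ (Submodule.span ℝ {M : Matrix (Sub 8 2) (Sub 8 2) ℝ | ∃ U : Set (Fin 5 → ℝ), IsOpen U ∧ U.Nonempty ∧ U ⊆ ksPosCone ∧ ∀ t ∈ U, ∃ Z : Chain ℝ 8 2, Z.IsCycle (ksMatrix t) ∧ Z.Effective ∧ compound 2 (ksMatrix t)⁻¹ * Z.classOf = M} : Set (Matrix (Sub 8 2) (Sub 8 2) ℝ))) →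
      (∃ M₀ ∈ {M : Matrix (Sub 8 2) (Sub 8 2) ℝ | ∀ t ∈ ksPosCone, eigenwave (compound 2 (ksMatrix t) * M) = 0}, M₀ ∉ (Submodule.span ℝ {M : Matrix (Sub 8 2) (Sub 8 2) ℝ | ∃ U : Set (Fin 5 → ℝ), IsOpen U ∧ U.Nonempty ∧ U ⊆ ksPosCone ∧ ∀ t ∈ U, ∃ Z : Chain ℝ 8 2, Z.IsCycle (ksMatrix t) ∧ Z.Effective ∧ compound 2 (ksMatrix t)⁻¹ * Z.classOf = M} : Set (Matrix (Sub 8 2) (Sub 8 2) ℝ))) →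
      EffectiveCayleyNonRealizability := by
    intro hAll hNot U hU hne hsub M hM
    by_contra hr
    push_neg at hr
    obtain ⟨M₀, hK, hspan⟩ := hNot
    exact hspan (hAll ⟨M, ⟨U, hU, hne, hsub, hM⟩, hr⟩ hK)
  exact key stub_allOrNothing stub_notAllRealizable

end Summit.HodgeConjecture.HodgeConjecture.Cruxes.EffectiveCayleyNonRealizability.Birth
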